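import Summits.Ventures.YMGap.RobustBall.ZTwoLayerIsing
import HarnessLib

/-!
# RobustBall/CentreProjectionEven — the `ℤ₂` SUB-TWIST projection for `SU(N)`, `N` EVEN: every twist-blind perturbation of the `SU(N)`
# Wilson action has its Wilson loops dominated by the loops of an induced INHOMOGENEOUS `ℤ₂` (Ising) gauge theory with couplings `|J_p| ≤ N|β|`

HONEST FRAMING: venture file of the cell `pub-ymgap` (QuantumFields programme), track Y2 ROBUST-BALL / DS seat ds-4 (g12).  WHAT THIS IS: an
INEQUALITY BETWEEN LATTICE EXPECTATIONS on a finite torus, for `SU(N)` with `N` EVEN.  The centre `ℤ_N` of `SU(N)` contains `{±1}` when `N` is even;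
averaging over the LINKWISE sub-twists `U_e ↦ ±U_e` only (instead of all of `ℤ_N`, as in `CentreProjection`) turns the Wilson weight into an
inhomogeneous `ℤ₂` gauge theory `h : links → ℤ/2` with plaquette weights `exp(β · sgn((curl h)_p) · Re tr U_p)` in the background `U`
(`z2WeightN`; couplings `J_p(U) = β Re tr U_p`, `|J_p| ≤ N|β|`), and the fundamental Wilson loop picks up `sgn(∮_C h)`.  Hence for every
twist-blind `W` (in particular every linkwise centre-blind `W` of rb-theory's class): `|⟨(1/N) Re tr U_{∂R×T}⟩_{β,W,L}| ≤ sup_U ‖z2LoopN β U‖`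
(`abs_expectation_wilsonLoop_le_of_isTwistBlind_even`).  For `N = 2` this is `CentreProjection` itself; for `N = 4, 6, …` it opens the `ℤ₂` route
(Griffiths' comparison, the Ising layers, Mack–Petkova domination by `ℤ₂` lattice gauge theory at `β₂ = N|β|`) to all even `N` — the comparison step
is `CentreProjectionEvenDomination`.  No area law is asserted in this file; nothing continuum / spectral / Clay.

Mechanism (as printed, for the full centre: J. Fröhlich, Phys. Lett. B 83 (1979) 195; G. Mack, V. B. Petkova, Ann. Phys. 123 (1979) 442, §2): product
Haar measure is invariant under `U ↦ ζ·U` for every fixed central `ζ`; here `ζ_e = ψ_N(N/2 · h_e)·1 = ±1`.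
-/

noncomputable section

open MeasureTheory Finset
open Literature.MathematicalPhysics.QuantumLattice (fundamentalRep fundamentalRep_apply continuous_fundamentalRep)
open Literature.MathematicalPhysics.QuantumFieldTheory

namespace Summit.Ventures.YMGap.RobustBall

variable {d L N : ℕ} [NeZero L] [NeZero N]

/-! ### The sub-twist `ℤ/2 → ℤ/N`, `1 ↦ N/2` -/

/-- The `ℤ₂` sub-twist value in `ℤ/N`: `a ↦ (N/2)·a`, i.e. `0 ↦ 0`, `1 ↦ N/2` (for `N` even this is the embedding `ℤ/2 ↪ ℤ/N`). [folklore] -/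
def halfTwist (N : ℕ) (a : ZMod 2) : ZMod N := ((N / 2 * a.val : ℕ) : ZMod N)

omit [NeZero L] [NeZero N] in
/-- `halfTwist 0 = 0`. [folklore] -/
@[simp] theorem halfTwist_zero : halfTwist N 0 = 0 := by simp [halfTwist]

omit [NeZero L] [NeZero N] in
/-- `halfTwist` is additive for `N` even. [folklore] -/
theorem halfTwist_add (hN : Even N) (a b : ZMod 2) : halfTwist N (a + b) = halfTwist N a + halfTwist N b := by
  unfold halfTwist
  rw [ZMod.val_add, ← Nat.cast_add, ← Nat.mul_add]
  set s := a.val + b.val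
  have key : N / 2 * s = N / 2 * (s % 2) + N * (s / 2) := by
    obtain ⟨m, hm⟩ := hN
    have h2 : N / 2 * 2 = N := by omega
    calc N / 2 * s = N / 2 * (s % 2 + 2 * (s / 2)) := by rw [Nat.mod_add_div]
      _ = N / 2 * (s % 2) + N / 2 * 2 * (s / 2) := by ring
      _ = N / 2 * (s % 2) + N * (s / 2) := by rw [h2]
  rw [key, Nat.cast_add, Nat.cast_mul N, ZMod.natCast_self, zero_mul, add_zero]

omit [NeZero L] [NeZero N] in
/-- `halfTwist a + halfTwist a = 0` for `N` even. [folklore] -/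
theorem halfTwist_add_self (hN : Even N) (a : ZMod 2) : halfTwist N a + halfTwist N a = 0 := by
  rw [← halfTwist_add hN, show a + a = 0 from by fin_cases a <;> decide, halfTwist_zero]

omit [NeZero L] [NeZero N] in
/-- `halfTwist (−a) = −halfTwist a` for `N` even. [folklore] -/
theorem halfTwist_neg (hN : Even N) (a : ZMod 2) : halfTwist N (-a) = -halfTwist N a := by
  rw [ZMod.neg_eq_self_mod_two, eq_neg_iff_add_eq_zero, halfTwist_add_self hN]

omit [NeZero L] [NeZero N] in
/-- `halfTwist (a − b) = halfTwist a − halfTwist b` for `N` even. [folklore] -/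
theorem halfTwist_sub (hN : Even N) (a b : ZMod 2) : halfTwist N (a - b) = halfTwist N a - halfTwist N b := by
  rw [sub_eq_add_neg, halfTwist_add hN, halfTwist_neg hN, ← sub_eq_add_neg]

omit [NeZero L] in
/-- **`ψ_N(halfTwist a) = sgn a`**: the sub-twists are `±1` (`N` even). [folklore] -/
theorem ψ_halfTwist (hN : Even N) (a : ZMod 2) : ψ N (halfTwist N a) = (ZTwo.sgn a : ℂ) := by
  by_cases ha : a = 0
  · subst ha
    simp
  · have ha1 : a = 1 := Literature.Probability.Percolation.Contour.zmod2_eq_one_of_ne_zero ha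
    subst ha1
    rw [ZTwo.sgn_one]
    have hv : (1 : ZMod 2).val = 1 := rfl
    simp only [halfTwist, hv, mul_one]
    push_cast
    have hc : ((N / 2 : ℕ) : ZMod N) = (((N / 2 : ℕ) : ℤ) : ZMod N) := (Int.cast_natCast _).symm
    rw [ψ, hc, ZMod.stdAddChar_coe]
    obtain ⟨m, hm⟩ := hN
    have hm2 : N / 2 = m := by omega
    have hNm : (N : ℂ) = 2 * m := by rw [hm]; push_cast; ring
    have hN0 : (N : ℂ) ≠ 0 := by exact_mod_cast (NeZero.ne N)
    have hm0 : (m : ℂ) ≠ 0 := by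
      intro h; apply hN0; rw [hNm, h, mul_zero]
    have harg : 2 * (Real.pi : ℂ) * Complex.I * ((((N / 2 : ℕ) : ℤ) : ℂ)) / (N : ℂ) = Real.pi * Complex.I := by
      rw [hm2, hNm]; push_cast; field_simp
    rw [harg, Complex.exp_pi_mul_I]

/-! ### Naturality of curl / line / loop sums under the sub-twist -/

omit [NeZero L] [NeZero N] in
/-- `curl (halfTwist ∘ h) = halfTwist (curl h)`. [folklore] -/
theorem plaqSum_halfTwist (hN : Even N) (h : Edge d L → ZMod 2) (x : Site d L) (i j : Fin d) :
    plaqSum (fun e => halfTwist N (h e)) x i j = halfTwist N (plaqSum h x i j) := by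
  unfold plaqSum
  rw [halfTwist_sub hN, halfTwist_sub hN, halfTwist_add hN]

omit [NeZero L] [NeZero N] in
/-- `lineSum (halfTwist ∘ h) = halfTwist (lineSum h)`. [folklore] -/
theorem lineSum_halfTwist (hN : Even N) (h : Edge d L → ZMod 2) (i : Fin d) :
    ∀ (n : ℕ) (y : Site d L), lineSum (fun e => halfTwist N (h e)) i n y = halfTwist N (lineSum h i n y)
  | 0, y => by simp [lineSum, halfTwist]
  | n + 1, y => by rw [lineSum, lineSum, lineSum_halfTwist hN h i n, halfTwist_add hN]

omit [NeZero L] [NeZero N] in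
/-- `∮ (halfTwist ∘ h) = halfTwist (∮ h)`. [folklore] -/
theorem loopSum_halfTwist (hN : Even N) (h : Edge d L → ZMod 2) (x : Site d L) (i j : Fin d) (R T : ℕ) :
    loopSum (fun e => halfTwist N (h e)) x i j R T = halfTwist N (loopSum h x i j R T) := by
  unfold loopSum
  rw [lineSum_halfTwist hN, lineSum_halfTwist hN, lineSum_halfTwist hN, lineSum_halfTwist hN, halfTwist_sub hN,
    halfTwist_sub hN, halfTwist_add hN]

/-! ### The induced inhomogeneous `ℤ₂` gauge theory of a background `U ∈ SU(N)^{links}` -/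

/-- The `ℤ₂` plaquette energy of `h` in the background `U`: `∑_p sgn((curl h)_p) · Re tr U_p`. [folklore] -/
def z2Energy (h : Edge d L → ZMod 2) (U : GaugeConfig d L (SUN N)) : ℝ :=
  ∑ p : Plaquette d L, ZTwo.sgn (plaqSum h p.1 p.2.1.1 p.2.1.2) *
    ((plaquetteHolonomy U p.1 p.2.1.1 p.2.1.2 : SUN N) : Matrix (Fin N) (Fin N) ℂ).trace.re

/-- The Boltzmann weight `exp(β · z2Energy h U)` of the induced `ℤ₂` gauge theory (one real coupling `β Re tr U_p`, `|β Re tr U_p| ≤ N|β|`, per plaquette).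
[folklore] -/
def z2WeightN (β : ℝ) (U : GaugeConfig d L (SUN N)) (h : Edge d L → ZMod 2) : ℝ :=
  Real.exp (β * z2Energy h U)

/-- **The `ℤ₂` Wilson loop of the induced theory**: `⟨sgn(∮_{∂R×T} h)⟩` under the weights `z2WeightN β U`. [folklore] -/
def z2LoopN (β : ℝ) (U : GaugeConfig d L (SUN N)) (x : Site d L) (i j : Fin d) (R T : ℕ) : ℂ :=
  FiniteGibbs.cavg (z2WeightN β U) fun h => (ZTwo.sgn (loopSum h x i j R T) : ℂ)

omit [NeZero N] in
/-- The `ℤ₂` weights are positive. [folklore] -/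
theorem z2WeightN_pos (β : ℝ) (U : GaugeConfig d L (SUN N)) (h : Edge d L → ZMod 2) : 0 < z2WeightN β U h := Real.exp_pos _

omit [NeZero N] in
/-- The `ℤ₂` partition function is positive. [folklore] -/
theorem mass_z2WeightN_pos (β : ℝ) (U : GaugeConfig d L (SUN N)) : 0 < FiniteGibbs.mass (z2WeightN β U) :=
  FiniteGibbs.mass_pos_of_pos (z2WeightN_pos β U)

omit [NeZero N] in
/-- `‖z2LoopN‖ ≤ 1`. [folklore] -/
theorem norm_z2LoopN_le_one (β : ℝ) (U : GaugeConfig d L (SUN N)) (x : Site d L) (i j : Fin d) (R T : ℕ) :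
    ‖z2LoopN β U x i j R T‖ ≤ 1 :=
  FiniteGibbs.norm_cavg_le (fun h => (z2WeightN_pos β U h).le) (mass_z2WeightN_pos β U) fun h => by
    rw [Complex.norm_real, Real.norm_eq_abs, ZTwo.abs_sgn]

/-- **The twist energy of a sub-twist is the `ℤ₂` energy**: `twistEnergy (halfTwist ∘ h) U = z2Energy h U` (`N` even). [folklore] -/
theorem twistEnergy_halfTwist (hN : Even N) (h : Edge d L → ZMod 2) (U : GaugeConfig d L (SUN N)) :
    twistEnergy (fun e => halfTwist N (h e)) U = z2Energy h U := by
  unfold twistEnergy z2Energy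
  refine Finset.sum_congr rfl fun p _ => ?_
  rw [plaqSum_halfTwist hN, ψ_halfTwist hN, Complex.re_ofReal_mul]

/-! ### Averaging over the sub-twists and the projection bound -/

/-- Averaging an integral against product Haar over all sub-twists `h : links → ℤ/2`. [folklore] -/
theorem integral_eq_avg_halfTwist {E : Type*} [NormedAddCommGroup E] [NormedSpace ℝ E] [CompleteSpace E]
    (g : GaugeConfig d L (SUN N) → E)
    (hg : ∀ h : Edge d L → ZMod 2, Integrable (fun U => g (twistOf (fun e => halfTwist N (h e)) * U))
      (Measure.pi fun _ : Edge d L => haarProbability (SUN N))) :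
    ∫ U, g U ∂(Measure.pi fun _ : Edge d L => haarProbability (SUN N)) =
      ∫ U, (Fintype.card (Edge d L → ZMod 2) : ℝ)⁻¹ • ∑ h : Edge d L → ZMod 2, g (twistOf (fun e => halfTwist N (h e)) * U)
        ∂(Measure.pi fun _ : Edge d L => haarProbability (SUN N)) := by
  set π := Measure.pi fun _ : Edge d L => haarProbability (SUN N) with hπ
  have hk : ∀ h : Edge d L → ZMod 2, ∫ U, g (twistOf (fun e => halfTwist N (h e)) * U) ∂π = ∫ U, g U ∂π := fun h =>
    (measurePreserving_twistEquiv (fun e => halfTwist N (h e))).integral_comp' (f := twistEquiv _) g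
  rw [integral_smul, integral_finsetSum _ fun h _ => hg h]
  simp only [hk, Finset.sum_const, Finset.card_univ]
  rw [← Nat.cast_smul_eq_nsmul ℝ, smul_smul, inv_mul_cancel₀ (by positivity), one_smul]

/-- **THE `ℤ₂` SUB-TWIST PROJECTION BOUND** (`SU(N)`, `N` EVEN): for every twist-blind perturbation `W` (in particular every linkwise centre-blind
one; no smallness / range / window) and every uniform bound `M` on the Wilson loop of the induced inhomogeneous `ℤ₂` gauge theory over all backgrounds
`U`, `|⟨(1/N) Re tr U_{∂R×T}⟩_{β,W,L}| ≤ M`.  HONEST LABEL: no area law asserted; the `ℤ₂` input `M` is supplied downstream.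
[cite: MackPetkova1979, §2] -/
theorem abs_expectation_wilsonLoop_le_of_isTwistBlind_even (hN : Even N) (W : Perturbation d L N) (hW : IsTwistBlind W)
    (β : ℝ) (x : Site d L) (i j : Fin d) (R T : ℕ) {M : ℝ}
    (hM : ∀ U : GaugeConfig d L (SUN N), ‖z2LoopN β U x i j R T‖ ≤ M) :
    |W.expectation (fundamentalRep (Fin N)) β (wilsonLoop (fundamentalRep (Fin N)) x i j R T)| ≤ M := by
  set ρ := fundamentalRep (Fin N) with hρdef
  have hρ : Continuous ρ := continuous_fundamentalRep (Fin N)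
  set π : Measure (GaugeConfig d L (SUN N)) := Measure.pi fun _ : Edge d L => haarProbability (SUN N) with hπ
  haveI : IsProbabilityMeasure π := by rw [hπ]; infer_instance
  set E : GaugeConfig d L (SUN N) → ℝ := fun U => -β * wilsonAction ρ U - W.total U with hE
  -- measurability / boundedness of the energy
  have hEm : Measurable E := QuasiLocalGaugePerturbation.measurable_action ρ hρ β W
  obtain ⟨CE, hCE⟩ := QuasiLocalGaugePerturbation.exists_abs_action_le ρ hρ β W
  have hexp_m : Measurable fun U => Real.exp (E U) := Real.measurable_exp.comp hEm
  have hexp_bd : ∀ U, ‖Real.exp (E U)‖ ≤ Real.exp CE := fun U => by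
    rw [Real.norm_eq_abs, abs_of_pos (Real.exp_pos _)]; exact Real.exp_le_exp.2 (le_of_abs_le (hCE U))
  have hexp_int : Integrable (fun U => Real.exp (E U)) π :=
    Integrable.of_bound hexp_m.aestronglyMeasurable (Real.exp CE) (Filter.Eventually.of_forall hexp_bd)
  have hZpos : 0 < ∫ U, Real.exp (E U) ∂π := integral_exp_pos hexp_int
  -- the complex integrand `g₁ = e^{E} · loopTrace`
  set lt := loopTrace (N := N) x i j R T with hlt
  have hlt_m : Measurable lt := (continuous_loopTrace x i j R T).measurable
  set g₁ : GaugeConfig d L (SUN N) → ℂ := fun U => (Real.exp (E U) : ℂ) * lt U with hg₁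
  -- Step 1: the expectation as a tilted integral
  have hexp_eq : W.expectation ρ β (wilsonLoop ρ x i j R T) =
      (∫ U, Real.exp (E U) * wilsonLoop ρ x i j R T U ∂π) / ∫ U, Real.exp (E U) ∂π := by
    rw [QuasiLocalGaugePerturbation.expectation, QuasiLocalGaugePerturbation.perturbedMeasure_eq_tilted ρ hρ β W,
      ← hπ, integral_tilted]
    simp only [smul_eq_mul]
    rw [← integral_div]
    exact integral_congr_ae (Filter.Eventually.of_forall fun U => by ring)
  -- Step 2: real part of the complex integral
  have hg₁_int : Integrable g₁ π := by
    refine Integrable.of_bound ((Complex.measurable_ofReal.comp hexp_m).mul hlt_m).aestronglyMeasurable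
      (Real.exp CE) (Filter.Eventually.of_forall fun U => ?_)
    rw [hg₁]; dsimp only
    rw [norm_mul, Complex.norm_real]
    calc ‖Real.exp (E U)‖ * ‖lt U‖ ≤ Real.exp CE * 1 :=
          mul_le_mul (hexp_bd U) (norm_loopTrace_le_one x i j R T U) (norm_nonneg _) (Real.exp_pos _).le
      _ = Real.exp CE := mul_one _
  have hre : ∫ U, Real.exp (E U) * wilsonLoop ρ x i j R T U ∂π = (∫ U, g₁ U ∂π).re := by
    have h := integral_re hg₁_int
    simp only [RCLike.re_to_complex] at h
    rw [← h]
    refine integral_congr_ae (Filter.Eventually.of_forall fun U => ?_)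
    show Real.exp (E U) * wilsonLoop ρ x i j R T U = ((Real.exp (E U) : ℂ) * lt U).re
    rw [Complex.re_ofReal_mul, hlt, wilsonLoop_eq_re_loopTrace]
  -- Step 3: sub-twisted integrands
  set P := Fintype.card (Plaquette d L) with hP
  set K := Fintype.card (Edge d L → ZMod 2) with hK
  have hK0 : (0 : ℝ) < K := by rw [hK]; exact_mod_cast Fintype.card_pos
  have hEtwist : ∀ (h : Edge d L → ZMod 2) (U : GaugeConfig d L (SUN N)),
      E (twistOf (fun e => halfTwist N (h e)) * U) = (-β * ((N : ℝ) * P) - W.total U) + β * z2Energy h U := by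
    intro h U
    simp only [hE]
    rw [wilsonAction_twist_eq, hW _ U, twistEnergy_halfTwist hN]
    ring
  -- the common positive density `G`
  set G : GaugeConfig d L (SUN N) → ℝ := fun U =>
    (K : ℝ)⁻¹ * (Real.exp (-β * ((N : ℝ) * P) - W.total U) * FiniteGibbs.mass (z2WeightN β U)) with hG
  have hG0 : ∀ U, 0 ≤ G U := fun U =>
    mul_nonneg (inv_nonneg.2 hK0.le) (mul_nonneg (Real.exp_pos _).le (mass_z2WeightN_pos β U).le)
  have hsum₀ : ∀ U, (K : ℝ)⁻¹ • ∑ h : Edge d L → ZMod 2, Real.exp (E (twistOf (fun e => halfTwist N (h e)) * U)) = G U := by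
    intro U
    simp only [hEtwist, Real.exp_add, ← Finset.mul_sum, smul_eq_mul, hG, FiniteGibbs.mass, z2WeightN]
  have hsum₁ : ∀ U, (K : ℝ)⁻¹ • ∑ h : Edge d L → ZMod 2, g₁ (twistOf (fun e => halfTwist N (h e)) * U) =
      (G U : ℂ) * (lt U * z2LoopN β U x i j R T) := by
    intro U
    have hm : (FiniteGibbs.mass (z2WeightN β U) : ℂ) ≠ 0 := by
      rw [Ne, Complex.ofReal_eq_zero]; exact (mass_z2WeightN_pos β U).ne'
    simp only [hg₁, hlt, loopTrace_twist, loopSum_halfTwist hN, ψ_halfTwist hN, hEtwist, Real.exp_add, Complex.ofReal_mul]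
    have hfac : ∑ h : Edge d L → ZMod 2, (Real.exp (-β * ((N : ℝ) * P) - W.total U) : ℂ) *
        (Real.exp (β * z2Energy h U) : ℂ) * ((ZTwo.sgn (loopSum h x i j R T) : ℂ) * loopTrace x i j R T U) =
        (Real.exp (-β * ((N : ℝ) * P) - W.total U) : ℂ) * loopTrace x i j R T U *
          ∑ h : Edge d L → ZMod 2, (z2WeightN β U h : ℂ) * (ZTwo.sgn (loopSum h x i j R T) : ℂ) := by
      rw [Finset.mul_sum]
      refine Finset.sum_congr rfl fun h _ => ?_
      rw [z2WeightN]; ring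
    rw [hfac, z2LoopN, FiniteGibbs.cavg, hG, Complex.real_smul]
    push_cast
    field_simp
  -- Step 4: the two averaged integrals
  have hZ : ∫ U, Real.exp (E U) ∂π = ∫ U, G U ∂π := by
    rw [integral_eq_avg_halfTwist (fun U => Real.exp (E U)) fun h => ?_]
    · exact integral_congr_ae (Filter.Eventually.of_forall hsum₀)
    · exact (measurePreserving_twistEquiv _).integrable_comp_emb (twistEquiv _).measurableEmbedding |>.2 hexp_int
  have hN₁ : ∫ U, g₁ U ∂π = ∫ U, (G U : ℂ) * (lt U * z2LoopN β U x i j R T) ∂π := by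
    rw [integral_eq_avg_halfTwist g₁ fun h => ?_]
    · exact integral_congr_ae (Filter.Eventually.of_forall hsum₁)
    · exact (measurePreserving_twistEquiv _).integrable_comp_emb (twistEquiv _).measurableEmbedding |>.2 hg₁_int
  -- Step 5: the norm bound
  have hGint : Integrable G π := by
    have h1 : Integrable (fun U => ∑ h : Edge d L → ZMod 2, Real.exp (E (twistOf (fun e => halfTwist N (h e)) * U))) π :=
      integrable_finsetSum Finset.univ fun h _ =>
        (measurePreserving_twistEquiv _).integrable_comp_emb (twistEquiv _).measurableEmbedding |>.2 hexp_int
    refine (integrable_congr (Filter.Eventually.of_forall fun U => ?_)).1 (h1.smul ((K : ℝ)⁻¹))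
    show (K : ℝ)⁻¹ • ∑ h : Edge d L → ZMod 2, Real.exp (E (twistOf (fun e => halfTwist N (h e)) * U)) = G U
    exact hsum₀ U
  have hbound : ‖∫ U, g₁ U ∂π‖ ≤ M * ∫ U, Real.exp (E U) ∂π := by
    rw [hN₁, hZ, ← integral_const_mul]
    refine (norm_integral_le_integral_norm _).trans (integral_mono_of_nonneg
      (Filter.Eventually.of_forall fun U => norm_nonneg _) (hGint.const_mul M)
      (Filter.Eventually.of_forall fun U => ?_))
    show ‖(G U : ℂ) * (lt U * z2LoopN β U x i j R T)‖ ≤ M * G U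
    rw [norm_mul, Complex.norm_real, Real.norm_eq_abs, abs_of_nonneg (hG0 U), norm_mul, mul_comm]
    refine mul_le_mul_of_nonneg_right ?_ (hG0 U)
    calc ‖lt U‖ * ‖z2LoopN β U x i j R T‖ ≤ 1 * M :=
          mul_le_mul (norm_loopTrace_le_one x i j R T U) (hM U) (norm_nonneg _) zero_le_one
      _ = M := one_mul M
  -- Step 6: conclude
  rw [hexp_eq, hre, abs_div, abs_of_pos hZpos, div_le_iff₀ hZpos]
  exact (Complex.abs_re_le_norm _).trans hbound

/-- The same for rb-theory's `IsCentreBlind`. [cite: MackPetkova1979, §2] -/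
theorem abs_expectation_wilsonLoop_le_of_isCentreBlind_even (hN : Even N) (W : Perturbation d L N) (hW : IsCentreBlind W)
    (β : ℝ) (x : Site d L) (i j : Fin d) (R T : ℕ) {M : ℝ}
    (hM : ∀ U : GaugeConfig d L (SUN N), ‖z2LoopN β U x i j R T‖ ≤ M) :
    |W.expectation (fundamentalRep (Fin N)) β (wilsonLoop (fundamentalRep (Fin N)) x i j R T)| ≤ M :=
  abs_expectation_wilsonLoop_le_of_isTwistBlind_even hN W hW.isTwistBlind β x i j R T hM

end Summit.Ventures.YMGap.RobustBall

end
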